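import Summits.BirchSwinnertonDyer.BirchSwinnertonDyer.Theorems.SignedLowerHalvesSmallImageLowerHalfBothSignsRttD2SeqJ3Localization
import Literature.NumberTheory.GaloisRepresentations.ContinuousShapiroLiftRestrictHom
import HarnessLib

/-!
# Route `SignedLowerHalves`, crux L `SmallImageLowerHalfBothSigns` (stmt-BirchSwinnertonDyer-23599), line `rtt_w3` v15 — E2, row J3 residual
# (`RSeq`), brick R4: THE INFLATION `infl_n : H¹(G_P(K_n), X_k) → H¹(U_n, X_k)` OF honda's LAYER GROUPS TO THE LAYER SUBGROUP `U_n = Gal(K̄/K_n) ≤ Γ_K`,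
# its compatibility with the localisations `loc_{n,w}` (R2's `θ_{U,w}^*`) and with the conjugation action, and the vanishing of inflated classes on the inertia
# groups off `P`

WIDTH seat `bsd-line-slh-p3-w3` g23 under LEAD `cruxlead-stmt-BirchSwinnertonDyer-23599` g11 (cell `bsd-ssimc`); helper `--supports stmt-BirchSwinnertonDyer-23599`.
DEFINITIONS WITH BODIES + THEOREMS; no named fact, no instance, no `sorry`. HONEST FRAMING: bookkeeping (pull-backs of continuous cocycles along `U_n → U_n N_P/N_P`);
it lets the Tate–Poitou reciprocity R3 (p794109, stated for classes of `H¹(U_n, ·)`) be applied to honda's classes `y ∈ H¹(G_P(K_n), X_k)` (`cycLayerCohO`, p782087) and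
identifies R2's local terms with J3's `locNK` (p789311). Nothing about any curve; E2, crux L, crux M, BSD remain OPEN and are proved for NO curve.

* §1 `coeffRepK S θ′ P k` (honda's coefficients `X_k = (𝒪 ⊗ μ_{p^k} ⊗ θ′)^{N_P}` as a `Γ_K`-module through `Γ_K ↠ G_P`), `layerQuotHom κ P n : U_n → (U_n)_P`, `inflMod`,
  ★ `inflNK S κ θ′ P n k : cycLayerCohO S κ θ′ P n k 1 →+ H¹(U_n, X_k)`.
* §2 ★ `map_comapSubtypeHom_inflNK` — `θ_{U_n,w}^* ∘ infl_n = loc_{n,w}` at EVERY finite place `w` (both are the pull-back along `U_{n,w} → (U_n)_P`);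
  ★ `conjMap_inflNK` — `g · infl_n y = infl_n (conj_g y)` (`cycLayerConjO`); ★ `resLe_inf_inertia_inflNK_eq_zero` — `infl_n y` dies on `U_n ⊓ I_𝔓` for every prime `𝔓` over a
  place `w ∉ P` (`I_𝔓 ≤ N_P`, tree `inertia_le_ramificationSubgroup`: the pulled-back cocycle is `τ ↦ f(1) = 0` there).
References: [NeukirchSchmidtWingberg2008] I §5, VIII §3; [SerreGaloisCohomology1997] I §2.2–2.5; [Kato2004Asterisque] §17.13.
-/

set_option autoImplicit false
set_option linter.dupNamespace false -- D-0017: single-problem summit, the namespace repeats the problem name by design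
noncomputable section

open scoped Classical
open NumberField IsDedekindDomain Field CategoryTheory Function

namespace Summit.BirchSwinnertonDyer.BirchSwinnertonDyer.Theorems.SmallImageRttD2Seq

open Literature.NumberTheory.EllipticCurves Literature.NumberTheory.GaloisRepresentations
  Literature.NumberTheory.ComplexMultiplication.EllipticUnits.JohnsonLeungKings2011
  Summit.BirchSwinnertonDyer.BirchSwinnertonDyer.Theorems.SmallImageRttD2J1

section Infl

variable {K : Type} [Field K] [NumberField K] {p : ℕ} [Fact p.Prime] (S : Set (PadicAlgCl p)) (κ : ZpExtension K p)
  (θ' : absoluteGaloisGroup K →ₜ* (padicCoeffIntegers S)ˣ) (P : Set (HeightOneSpectrum (𝓞 K)))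

/-! ## §1. The inflation -/

/-- **honda's coefficients `X_k = (𝒪 ⊗ μ_{p^k} ⊗ θ′)^{N_P}` as a discrete `Γ_K`-module** (through `Γ_K ↠ G_P`; restricted further along `res_w` this is `locCoeffRep S θ′ P w k`,
definitionally). [cite: JohnsonLeungKings2011, Def. 4.2] [cite: Kato2004Asterisque, §17.13] -/
abbrev coeffRepK (k : ℕ) :
    ContinuousRep (absoluteGaloisGroup K) ℤ ↥(Representation.invariants ((muTwistO S θ' k).toRepresentation.comp (ramificationSubgroup K P).subtype)) :=
  (coeffGSO S P θ' k).restrict (toUnramifiedQuotCont K P)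

/-- **`U_n → (U_n)_P = U_n N_P / N_P`**: the projection `Γ_K ↠ G_P` restricted to the layer subgroup `U_n = Gal(K̄/K_n)`, corestricted to its image. [cite: NeukirchSchmidtWingberg2008, VIII §3] -/
def layerQuotHom (n : ℕ) : ↥(κ.layerSubgroup n) →ₜ* ↥(imGS P (κ.layerSubgroup n)) where
  toFun u := ⟨toUnramifiedQuot K P u, Subgroup.mem_map_of_mem _ u.2⟩
  map_one' := Subtype.ext (map_one _)
  map_mul' a b := Subtype.ext (map_mul _ _ _)
  continuous_toFun := by
    apply Continuous.subtype_mk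
    exact (continuous_toUnramifiedQuot K P).comp continuous_subtype_val

omit [NumberField K] in
/-- Unfolding `layerQuotHom`. [folklore] -/
theorem layerQuotHom_apply_coe (n : ℕ) (u : ↥(κ.layerSubgroup n)) :
    ((layerQuotHom κ P n u : ↥(imGS P (κ.layerSubgroup n))) : GaloisGroupUnramifiedOutside K P) = toUnramifiedQuot K P u :=
  rfl

/-- The coefficient morphism over `layerQuotHom`: the identity on vectors of `X_k`. [folklore] -/
def inflMod (n k : ℕ) :
    TopRep.res (layerQuotHom κ P n : _ →* _) (subgroupRep (coeffGSO S P θ' k).toTopRep (imGS P (κ.layerSubgroup n))) ⟶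
      subgroupRep (coeffRepK S θ' P k).toTopRep (κ.layerSubgroup n) :=
  TopRep.ofHom ⟨ContinuousLinearMap.id ℤ _, fun _ ↦ rfl⟩

/-- ★ **The inflation `infl_n : H¹(G_P(K_n), X_k) → H¹(U_n, X_k)`** (pull-back along `U_n → (U_n)_P`, identity on coefficients). [cite: NeukirchSchmidtWingberg2008, I §5]
[cite: SerreGaloisCohomology1997, I §2.4] -/
def inflNK (n k : ℕ) :
    cycLayerCohO S κ θ' P n k 1 →+ (continuousCohomology 1 (subgroupRep (coeffRepK S θ' P k).toTopRep (κ.layerSubgroup n)) : Type) :=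
  (ContinuousCohomology.map (layerQuotHom κ P n) (inflMod S κ θ' P n k) 1).hom.toLinearMap.toAddMonoidHom

omit [NumberField K] in
/-- Unfolding `inflNK`. [folklore] -/
theorem inflNK_apply (n k : ℕ) (y : cycLayerCohO S κ θ' P n k 1) :
    inflNK S κ θ' P n k y = ContinuousCohomology.map (layerQuotHom κ P n) (inflMod S κ θ' P n k) 1 y :=
  rfl

/-! ## §2. Compatibilities -/

/-- ★ **`θ_{U_n,w}^* ∘ infl_n = loc_{n,w}`** at every finite place `w`: restricting the inflated class along `U_{n,w} = res_w⁻¹ U_n → U_n` (R2's `θ_{U,w}^*`: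
`comapSubtypeHom`/`comapCoeffHom`) IS g22's localisation `locNK S κ θ′ P w n k` (both are the pull-back along `U_{n,w} → (U_n)_P`, identity on vectors). The two sides
live in definitionally equal types (`X_k|_{res_w} = locCoeffRep`, `res_w⁻¹U_n = localSubgroupOfEmb U_n`). [cite: NeukirchSchmidtWingberg2008, I §5 (1.5.6)] -/
theorem map_comapSubtypeHom_inflNK (w : HeightOneSpectrum (𝓞 K)) (n k : ℕ) (y : cycLayerCohO S κ θ' P n k 1) :
    ContinuousCohomology.map (comapSubtypeHom (κ.layerSubgroup n) (resGalOfEmb (closureEmb (K := K) (w.adicCompletion K))))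
        (comapCoeffHom (coeffRepK S θ' P k).toTopRep (κ.layerSubgroup n) (resGalOfEmb (closureEmb (K := K) (w.adicCompletion K)))) 1
        (inflNK S κ θ' P n k y) =
      locNK S κ θ' P w n k y := by
  rw [inflNK_apply, locNK_apply]
  exact (map_comp_apply_of (layerQuotHom κ P n) (comapSubtypeHom (κ.layerSubgroup n) (resGalOfEmb (closureEmb (K := K) (w.adicCompletion K))))
    (locLayerHom κ P w n) (fun _ ↦ rfl) (inflMod S κ θ' P n k)
    (comapCoeffHom (coeffRepK S θ' P k).toTopRep (κ.layerSubgroup n) (resGalOfEmb (closureEmb (K := K) (w.adicCompletion K))))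
    (locLayerMod S κ θ' P w n k) (fun _ ↦ rfl) 1 y).symm

omit [NumberField K] in
/-- ★ **`g · infl_n y = infl_n (conj_g y)`**: the inflation intertwines the conjugation action of `g ∈ Γ_K` on `H¹(U_n, X_k)` (tree `conjMap`) with honda's
`cycLayerConjO` (conjugation by `π g` on `H¹((U_n)_P, X_k)`); both composites are the map of the pair `(u ↦ π(g⁻¹ u g), v ↦ θ′-action of g)`.
[cite: NeukirchSchmidtWingberg2008, I §5 Prop. 1.5.3 (iii)] [cite: SerreLocalFields1979, VII §5] -/
theorem conjMap_inflNK (n k : ℕ) (g : absoluteGaloisGroup K) (y : cycLayerCohO S κ θ' P n k 1) :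
    conjMap (coeffRepK S θ' P k).toTopRep (κ.layerSubgroup n) g 1 (inflNK S κ θ' P n k y) = inflNK S κ θ' P n k (cycLayerConjO S κ θ' P n k 1 g y) := by
  haveI : (imGS P (κ.layerSubgroup n)).Normal := Subgroup.Normal.map inferInstance _ (toUnramifiedQuot_surjective K P)
  rw [inflNK_apply, inflNK_apply, cycLayerConjO, levelConjO_apply]
  unfold conjMap
  -- both sides are `map χ h 1 y` for `χ = layerQuotHom ∘ (u ↦ g⁻¹ u g)` and `h = (v ↦ θ′-action of g)`
  have e1 := map_comp_apply_of (layerQuotHom κ P n) (Literature.NumberTheory.EllipticCurves.subgroupConj _ g)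
      ((layerQuotHom κ P n).comp (Literature.NumberTheory.EllipticCurves.subgroupConj _ g)) (fun _ ↦ rfl)
      (inflMod S κ θ' P n k) (conjRepHom (coeffRepK S θ' P k).toTopRep _ g)
      (TopRep.ofHom ⟨((coeffGSO S P θ' k).toTopRep.ρ (toUnramifiedQuot K P g) : _ →L[ℤ] _), fun u ↦ ContinuousLinearMap.ext fun x ↦ by
        change (coeffGSO S P θ' k) (toUnramifiedQuot K P g) ((coeffGSO S P θ' k) (toUnramifiedQuot K P ((g⁻¹ * u * g : absoluteGaloisGroup K))) x) =
          (coeffGSO S P θ' k) (toUnramifiedQuot K P (u : absoluteGaloisGroup K)) ((coeffGSO S P θ' k) (toUnramifiedQuot K P g) x)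
        rw [← Module.End.mul_apply, ← map_mul, ← Module.End.mul_apply, ← map_mul, ← map_mul, ← map_mul, ← mul_assoc, ← mul_assoc, mul_inv_cancel,
          one_mul]⟩) (fun _ ↦ rfl) 1 y
  have e2 := map_comp_apply_of (Literature.NumberTheory.EllipticCurves.subgroupConj _ (toUnramifiedQuot K P g)) (layerQuotHom κ P n)
      ((layerQuotHom κ P n).comp (Literature.NumberTheory.EllipticCurves.subgroupConj _ g))
      (fun u ↦ Subtype.ext (by simp [layerQuotHom_apply_coe, Literature.NumberTheory.EllipticCurves.subgroupConj_apply_coe, map_mul, map_inv]))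
      (conjRepHom (coeffGSO S P θ' k).toTopRep _ (toUnramifiedQuot K P g)) (inflMod S κ θ' P n k)
      (TopRep.ofHom ⟨((coeffGSO S P θ' k).toTopRep.ρ (toUnramifiedQuot K P g) : _ →L[ℤ] _), fun u ↦ ContinuousLinearMap.ext fun x ↦ by
        change (coeffGSO S P θ' k) (toUnramifiedQuot K P g) ((coeffGSO S P θ' k) (toUnramifiedQuot K P ((g⁻¹ * u * g : absoluteGaloisGroup K))) x) =
          (coeffGSO S P θ' k) (toUnramifiedQuot K P (u : absoluteGaloisGroup K)) ((coeffGSO S P θ' k) (toUnramifiedQuot K P g) x)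
        rw [← Module.End.mul_apply, ← map_mul, ← Module.End.mul_apply, ← map_mul, ← map_mul, ← map_mul, ← mul_assoc, ← mul_assoc, mul_inv_cancel,
          one_mul]⟩) (fun _ ↦ rfl) 1 y
  exact e1.symm.trans e2

set_option maxHeartbeats 400000 in
omit [NumberField K] in
/-- ★ **Inflated classes die on the inertia groups off `P`**: for a finite place `w ∉ P` and a prime `𝔓` of `K̄` over `w`, `res_{U_n ⊓ I_𝔓}(infl_n y) = 0` — `I_𝔓 ≤ N_P`
(tree `inertia_le_ramificationSubgroup`) maps to `1` in `(U_n)_P`, so the pulled-back cocycle is `τ ↦ f(1) = 0`. This is the hypothesis "`a` dies on `U ⊓ I_𝔓` off `T`" of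
R3 for `T ⊇ P`. [cite: NeukirchSchmidtWingberg2008, VIII §3] [cite: SerreGaloisCohomology1997, I §5.1] -/
theorem resLe_inf_inertia_inflNK_eq_zero (n k : ℕ) {w : HeightOneSpectrum (𝓞 K)} (hw : w ∉ P) {𝔓 : Ideal (absIntegers (𝓞 K) K)}
    (h𝔓 : 𝔓 ∈ w.primesAbove) (y : cycLayerCohO S κ θ' P n k 1) :
    resLe (coeffRepK S θ' P k).toTopRep (inf_le_left : κ.layerSubgroup n ⊓ 𝔓.inertia (absoluteGaloisGroup K) ≤ κ.layerSubgroup n) 1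
      (inflNK S κ θ' P n k y) = 0 := by
  obtain ⟨f, rfl⟩ := oneCocycleClass_surjective ((levelRepO S P θ' (κ.layerSubgroup n) k).toTopRep) y
  have h1 : inflNK S κ θ' P n k (oneCocycleClass _ f) =
      oneCocycleClass _ (contOneCocycles.pullback (layerQuotHom κ P n) (inflMod S κ θ' P n k) f) :=
    map_oneCocycleClass _ _ _ f
  rw [h1, resLe_oneCocycleClass, oneCocycleClass_eq_zero_iff]
  refine ⟨0, fun τ ↦ ?_⟩
  have hτ1 : (τ : absoluteGaloisGroup K) ∈ 𝔓.inertia (absoluteGaloisGroup K) := (Subgroup.mem_inf.mp τ.2).2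
  have hτ : layerQuotHom κ P n (Literature.NumberTheory.EllipticCurves.subgroupInclusion
      (inf_le_left : κ.layerSubgroup n ⊓ 𝔓.inertia (absoluteGaloisGroup K) ≤ κ.layerSubgroup n) τ) = 1 := by
    refine Subtype.ext ?_
    rw [layerQuotHom_apply_coe, Literature.NumberTheory.EllipticCurves.subgroupInclusion_apply_coe, OneMemClass.coe_one]
    exact (QuotientGroup.eq_one_iff _).mpr (inertia_le_ramificationSubgroup hw h𝔓 hτ1)
  rw [contOneCocycles.pullback_apply, contOneCocycles.pullback_apply, hτ]
  have h0 : f.1 1 = 0 := contOneCocycles.apply_one f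
  rw [h0, sub_zero]
  exact (ContinuousLinearMap.map_zero _).symm

end Infl

end Summit.BirchSwinnertonDyer.BirchSwinnertonDyer.Theorems.SmallImageRttD2Seq

end
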